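import Literature.Analysis.UnboundedOperators.LumerPhillips
import Literature.Analysis.UnboundedOperators.HilleYosidaRescaled
import Mathlib.Analysis.InnerProductSpace.Basic
import HarnessLib

/-!
# Lumer–Phillips with a growth bound: a quasi-dissipative operator with the range condition generates a
  quasi-contractive C₀-semigroup `‖T(t)‖ ≤ e^{ωt}` (Engel–Nagel II Thm. 3.15 + rescaling II.2.2); the Hilbert-space form
  `Re⟪Ax, x⟫ ≤ ω‖x‖²`

Analysis/UnboundedOperators support file (one `structure` of hypotheses, three definitions with bodies,
everything proved, no named facts). `LumerPhillips.lean` treats the contraction case (`ω = 0`). Operators of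
applications (linearisations, drift–diffusion operators, Schrödinger-type forms) are usually only
QUASI-dissipative: `(λ − ω)‖x‖ ≤ ‖(λ − A)x‖` for `λ > ω`, i.e. `A − ω` is dissipative. With the range condition
(`λ − A` onto for `λ > ω`) such an `A` generates a C₀-semigroup with `‖T(t)‖ ≤ e^{ωt}` (Engel–Nagel II Thm. 3.15
applied to `A − ω`, rescaled back by II.2.2). Here this is obtained DIRECTLY from the pseudo-resolvent form of the
Hille–Yosida theorem with a shifted bound (`HilleYosidaRescaled.exists_c0Semigroup_of_resolvent_bound`):

* `IsQuasiDissipativeData A ω` — dense domain, quasi-dissipativity and the range condition for real `λ > ω`;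
* `qResolvent h hl : E →L[ℂ] E` — `(λ − A)⁻¹` with `‖(λ − A)⁻¹‖ ≤ 1/(λ − ω)`; `qFamily` — the family on the
  real half-line `{Im z = 0, Re z > ω}`, a pseudo-resolvent (`isPseudoResolvent_qFamily`);
* **`IsQuasiDissipativeData.exists_c0Semigroup`** — `∃ T`, `‖T(t)‖ ≤ e^{ωt}`, Laplace transform `(λ − A)⁻¹`
  (`λ > ω`), `T.generator = A`;
* Hilbert space: `quasiDissipative_of_re_inner_le` — `Re⟪Ax, x⟫ ≤ ω‖x‖²` implies quasi-dissipativity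
  (Engel–Nagel II 3.23 / Ex. 3.26), hence **`exists_c0Semigroup_of_re_inner_le`**;
* `IsLumerPhillipsData.isQuasiDissipativeData` — the contraction case is `ω = 0`.

## References

* K.-J. Engel, R. Nagel, *One-Parameter Semigroups for Linear Evolution Equations* (2000), Ch. II
  Def. 3.13, Prop. 3.14, Thm. 3.15, Prop. 3.23, §2.2 (rescaling). [EngelNagel2000]
-/

noncomputable section

open NormedSpace Filter Set Metric Literature.Analysis.OperatorTheory
open scoped Topology NNReal ComplexConjugate

namespace Literature.Analysis.UnboundedOperators

namespace HilleYosida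

open IsLumerPhillipsData (subMap subMap_apply)

variable {E : Type*} [NormedAddCommGroup E] [NormedSpace ℂ E] [CompleteSpace E]

/-- **Quasi-dissipative data with growth bound `ω`**: dense domain, `(λ − ω)‖x‖ ≤ ‖λx − Ax‖` and `λ − A` onto, for
all real `λ > ω` (i.e. `A − ω` is m-dissipative). [cite: EngelNagel2000, Ch. II Thm. 3.15] -/
structure IsQuasiDissipativeData (A : E →ₗ.[ℂ] E) (ω : ℝ) : Prop where
  /-- `D(A)` is dense -/
  dense : Dense (A.domain : Set E)
  /-- quasi-dissipativity: `(λ − ω)‖x‖ ≤ ‖λx − Ax‖` for `λ > ω`, `x ∈ D(A)` -/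
  dissipative : ∀ l : ℝ, ω < l → ∀ x : A.domain, (l - ω) * ‖(x : E)‖ ≤ ‖(l : ℂ) • (x : E) - A x‖
  /-- range condition: `λ − A` is onto for `λ > ω` -/
  surj : ∀ l : ℝ, ω < l → ∀ y : E, ∃ x : A.domain, (l : ℂ) • (x : E) - A x = y

omit [CompleteSpace E] in
/-- The contraction case: Lumer–Phillips data are quasi-dissipative data with `ω = 0`. [cite: EngelNagel2000, Ch. II Thm. 3.15] -/
theorem IsLumerPhillipsData.isQuasiDissipativeData {A : E →ₗ.[ℂ] E} (h : IsLumerPhillipsData A) :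
    IsQuasiDissipativeData A 0 where
  dense := h.dense
  dissipative l hl x := by rw [sub_zero]; exact h.dissipative l hl x
  surj := h.surj

namespace IsQuasiDissipativeData

variable {A : E →ₗ.[ℂ] E} {ω : ℝ}

/-! ### `(λ − A)⁻¹` for `λ > ω` -/

omit [CompleteSpace E] in
/-- Quasi-dissipativity makes `λ − A` injective (`λ > ω`). [cite: EngelNagel2000, Ch. II Prop. 3.14] -/
theorem injective_subMap (h : IsQuasiDissipativeData A ω) {l : ℝ} (hl : ω < l) : Function.Injective (subMap A l) := by
  refine (injective_iff_map_eq_zero _).2 fun x hx => ?_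
  have hd := h.dissipative l hl x
  rw [← subMap_apply, hx, norm_zero] at hd
  have hl' : 0 < l - ω := sub_pos.2 hl
  have hx0 : ‖(x : E)‖ = 0 := le_antisymm (by nlinarith [norm_nonneg (x : E)]) (norm_nonneg _)
  exact Subtype.ext (norm_eq_zero.1 hx0)

omit [CompleteSpace E] in
/-- `λ − A : D(A) → E` is bijective (`λ > ω`). [cite: EngelNagel2000, Ch. II Thm. 3.15] -/
theorem bijective_subMap (h : IsQuasiDissipativeData A ω) {l : ℝ} (hl : ω < l) : Function.Bijective (subMap A l) :=
  ⟨h.injective_subMap hl, fun y => by obtain ⟨x, hx⟩ := h.surj l hl y; exact ⟨x, hx⟩⟩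

/-- The linear inverse `(λ − A)⁻¹ : E → D(A) ⊆ E` (`λ > ω`). [cite: EngelNagel2000, Ch. II Thm. 3.15] -/
def qResolventLM (h : IsQuasiDissipativeData A ω) {l : ℝ} (hl : ω < l) : E →ₗ[ℂ] E :=
  A.domain.subtype.comp (LinearEquiv.ofBijective (subMap A l) (h.bijective_subMap hl)).symm.toLinearMap

omit [CompleteSpace E] in
/-- `(λ − A)⁻¹ y ∈ D(A)`. [cite: EngelNagel2000, Ch. II Thm. 3.15] -/
theorem qResolventLM_mem (h : IsQuasiDissipativeData A ω) {l : ℝ} (hl : ω < l) (y : E) : h.qResolventLM hl y ∈ A.domain :=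
  ((LinearEquiv.ofBijective (subMap A l) (h.bijective_subMap hl)).symm y).2

omit [CompleteSpace E] in
/-- `(λ − A)((λ − A)⁻¹ y) = y`. [cite: EngelNagel2000, Ch. II Thm. 3.15] -/
theorem subMap_qResolventLM (h : IsQuasiDissipativeData A ω) {l : ℝ} (hl : ω < l) (y : E) :
    subMap A l ⟨h.qResolventLM hl y, h.qResolventLM_mem hl y⟩ = y := by
  have h1 := (LinearEquiv.ofBijective (subMap A l) (h.bijective_subMap hl)).apply_symm_apply y
  rw [LinearEquiv.ofBijective_apply] at h1
  exact h1

omit [CompleteSpace E] in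
/-- `(λ − A)⁻¹((λ − A) x) = x` for `x ∈ D(A)`. [cite: EngelNagel2000, Ch. II Thm. 3.15] -/
theorem qResolventLM_subMap (h : IsQuasiDissipativeData A ω) {l : ℝ} (hl : ω < l) (x : A.domain) :
    h.qResolventLM hl (subMap A l x) = x := by
  have h1 := (LinearEquiv.ofBijective (subMap A l) (h.bijective_subMap hl)).symm_apply_apply x
  rw [LinearEquiv.ofBijective_apply] at h1
  show ((LinearEquiv.ofBijective (subMap A l) (h.bijective_subMap hl)).symm (subMap A l x) : E) = x
  rw [h1]

omit [CompleteSpace E] in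
/-- **`‖(λ − A)⁻¹ y‖ ≤ ‖y‖/(λ − ω)`** (quasi-dissipativity). [cite: EngelNagel2000, Ch. II Prop. 3.14] -/
theorem norm_qResolventLM_le (h : IsQuasiDissipativeData A ω) {l : ℝ} (hl : ω < l) (y : E) :
    ‖h.qResolventLM hl y‖ ≤ (l - ω)⁻¹ * ‖y‖ := by
  have hd := h.dissipative l hl ⟨h.qResolventLM hl y, h.qResolventLM_mem hl y⟩
  rw [← subMap_apply, h.subMap_qResolventLM hl y] at hd
  rw [inv_mul_eq_div, le_div_iff₀ (sub_pos.2 hl), mul_comm]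
  exact hd

/-- **The resolvent `(λ − A)⁻¹` as a bounded operator** (`λ > ω`). [cite: EngelNagel2000, Ch. II Thm. 3.15] -/
def qResolvent (h : IsQuasiDissipativeData A ω) {l : ℝ} (hl : ω < l) : E →L[ℂ] E :=
  LinearMap.mkContinuous (h.qResolventLM hl) (l - ω)⁻¹ (h.norm_qResolventLM_le hl)

omit [CompleteSpace E] in
/-- `qResolvent` acts as `qResolventLM`. [cite: EngelNagel2000, Ch. II Thm. 3.15] -/
theorem qResolvent_apply (h : IsQuasiDissipativeData A ω) {l : ℝ} (hl : ω < l) (y : E) : h.qResolvent hl y = h.qResolventLM hl y := rfl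

omit [CompleteSpace E] in
/-- `‖(λ − A)⁻¹‖ ≤ 1/(λ − ω)`. [cite: EngelNagel2000, Ch. II Thm. 3.15] -/
theorem norm_qResolvent_le (h : IsQuasiDissipativeData A ω) {l : ℝ} (hl : ω < l) : ‖h.qResolvent hl‖ ≤ (l - ω)⁻¹ :=
  LinearMap.mkContinuous_norm_le _ (inv_nonneg.2 (sub_pos.2 hl).le) _

omit [CompleteSpace E] in
/-- `(λ − A)⁻¹ y ∈ D(A)` and `λ(λ − A)⁻¹y − A((λ − A)⁻¹y) = y`. [cite: EngelNagel2000, Ch. II Thm. 3.15] -/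
theorem sub_apply_qResolvent (h : IsQuasiDissipativeData A ω) {l : ℝ} (hl : ω < l) (y : E) :
    ∃ hy : h.qResolvent hl y ∈ A.domain, (l : ℂ) • h.qResolvent hl y - A ⟨h.qResolvent hl y, hy⟩ = y :=
  ⟨h.qResolventLM_mem hl y, h.subMap_qResolventLM hl y⟩

omit [CompleteSpace E] in
/-- `(λ − A)⁻¹(λx − Ax) = x` for `x ∈ D(A)`. [cite: EngelNagel2000, Ch. II Thm. 3.15] -/
theorem qResolvent_sub_apply (h : IsQuasiDissipativeData A ω) {l : ℝ} (hl : ω < l) (x : A.domain) :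
    h.qResolvent hl ((l : ℂ) • (x : E) - A x) = x :=
  h.qResolventLM_subMap hl x

omit [CompleteSpace E] in
/-- **The resolvent identity** `R_λ y − R_μ y = (μ − λ)·R_λ(R_μ y)` for real `λ, μ > ω`. [cite: EngelNagel2000, Ch. II Thm. 3.15] -/
theorem qResolvent_sub (h : IsQuasiDissipativeData A ω) {l m : ℝ} (hl : ω < l) (hm : ω < m) (y : E) :
    h.qResolvent hl y - h.qResolvent hm y = ((m : ℂ) - l) • h.qResolvent hl (h.qResolvent hm y) := by
  obtain ⟨hx, hxeq⟩ := h.sub_apply_qResolvent hm y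
  set x : A.domain := ⟨h.qResolvent hm y, hx⟩ with hxdef
  have hy : y = ((l : ℂ) • (x : E) - A x) + ((m : ℂ) - l) • (x : E) := by
    rw [← hxeq]; simp only [hxdef]; rw [sub_smul]; abel
  have h1 : h.qResolvent hl y = (x : E) + ((m : ℂ) - l) • h.qResolvent hl (x : E) := by
    conv_lhs => rw [hy]
    rw [map_add, map_smul, h.qResolvent_sub_apply hl x]
  rw [h1]
  simp only [hxdef]
  abel

/-! ### The pseudo-resolvent on `{Im z = 0, Re z > ω}` and the generation theorem -/

/-- The resolvent family on `ℂ`: `(Re z − A)⁻¹` for `Re z > ω`, junk `0` otherwise (only real points are used).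
[cite: EngelNagel2000, Ch. II Thm. 3.15] -/
def qFamily (h : IsQuasiDissipativeData A ω) (z : ℂ) : E →L[ℂ] E :=
  if hz : ω < z.re then h.qResolvent hz else 0

omit [CompleteSpace E] in
/-- On a real `λ > ω` the family is `(λ − A)⁻¹`. [cite: EngelNagel2000, Ch. II Thm. 3.15] -/
theorem qFamily_ofReal (h : IsQuasiDissipativeData A ω) {l : ℝ} (hl : ω < l) : h.qFamily l = h.qResolvent hl := by
  have hl' : ω < (l : ℂ).re := by simpa using hl
  rw [qFamily, dif_pos hl']

omit [CompleteSpace E] in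
/-- **Pseudo-resolvent** on `U = {z : Im z = 0, Re z > ω}`. [cite: EngelNagel2000, Ch. II Thm. 3.15] -/
theorem isPseudoResolvent_qFamily (h : IsQuasiDissipativeData A ω) :
    IsPseudoResolvent {z : ℂ | z.im = 0 ∧ ω < z.re} h.qFamily := by
  intro z hz w hw
  obtain ⟨hzi, hzr⟩ := hz
  obtain ⟨hwi, hwr⟩ := hw
  have hz' : z = (z.re : ℂ) := by apply Complex.ext <;> simp [hzi]
  have hw' : w = (w.re : ℂ) := by apply Complex.ext <;> simp [hwi]
  rw [hz', hw', h.qFamily_ofReal hzr, h.qFamily_ofReal hwr]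
  ext y
  rw [sub_apply, h.qResolvent_sub hzr hwr y, smul_apply, mul_apply_eq_comp]

omit [CompleteSpace E] in
/-- `D(A) ⊆ range (λ − A)⁻¹`, so the range is dense. [cite: EngelNagel2000, Ch. II Thm. 3.15] -/
theorem dense_range_qFamily (h : IsQuasiDissipativeData A ω) {l : ℝ} (hl : ω < l) : Dense (Set.range (h.qFamily l)) := by
  rw [h.qFamily_ofReal hl]
  refine h.dense.mono fun x hx => ⟨(l : ℂ) • x - A ⟨x, hx⟩, ?_⟩
  exact h.qResolvent_sub_apply hl ⟨x, hx⟩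

omit [CompleteSpace E] in
/-- The closed operator of the family at a real `λ > ω` IS `A` (graph comparison). [cite: EngelNagel2000, Ch. II Thm. 3.15] -/
theorem operatorOfResolvent_qFamily (h : IsQuasiDissipativeData A ω) {l : ℝ} (hl : ω < l)
    (hinj : Function.Injective (h.qFamily l)) : operatorOfResolvent h.qFamily l hinj = A := by
  have h1 := h.qFamily_ofReal hl
  apply LinearPMap.eq_of_eq_graph
  ext p
  rw [mem_graph_operatorOfResolvent_iff, LinearPMap.mem_graph_iff, h1]
  constructor
  · intro hp
    obtain ⟨hy, hyeq⟩ := h.sub_apply_qResolvent hl ((l : ℂ) • p.1 - p.2)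
    have hmem : p.1 ∈ A.domain := by rw [← hp]; exact hy
    refine ⟨⟨p.1, hmem⟩, rfl, ?_⟩
    have heq : (⟨h.qResolvent hl ((l : ℂ) • p.1 - p.2), hy⟩ : A.domain) = ⟨p.1, hmem⟩ := Subtype.ext hp
    rw [heq, hp] at hyeq
    exact sub_right_injective (show (l : ℂ) • p.1 - A ⟨p.1, hmem⟩ = (l : ℂ) • p.1 - p.2 from hyeq)
  · rintro ⟨x, hx1, hx2⟩
    rw [← hx1, ← hx2]
    exact h.qResolvent_sub_apply hl x

/-- **LUMER–PHILLIPS WITH GROWTH BOUND (Engel–Nagel II Thm. 3.15 + II.2.2).** A densely defined operator `A` on a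
complex Banach space with `(λ − ω)‖x‖ ≤ ‖λx − Ax‖` and `λ − A` onto for all real `λ > ω` generates a C₀-semigroup
`T` with `‖T(t)‖ ≤ e^{ωt}` and `T.generator = A`; its Laplace transform at real `λ > ω` is `(λ − A)⁻¹`. (Unique by
`C0Semigroup.eq_of_generator_eq`.) [cite: EngelNagel2000, Ch. II Thm. 3.15] -/
theorem exists_c0Semigroup (h : IsQuasiDissipativeData A ω) :
    ∃ T : C0Semigroup ℂ E, (∀ t : ℝ≥0, ‖T.app t‖ ≤ Real.exp (ω * t)) ∧
      (∀ l : ℝ, ∀ hl : ω < l, ∀ x : E, T.laplaceResolventFun l x = h.qResolvent hl x) ∧ T.generator = A := by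
  have hω1 : ω < ω + 1 := lt_add_one ω
  have hmem : ∀ l : ℝ, -(-ω) < l → (l : ℂ) ∈ {z : ℂ | z.im = 0 ∧ ω < z.re} := fun l hl => by
    rw [neg_neg] at hl; simpa using hl
  have hbound : ∀ l : ℝ, -(-ω) < l → ‖h.qFamily l‖ ≤ (l + -ω)⁻¹ := fun l hl => by
    rw [neg_neg] at hl
    rw [h.qFamily_ofReal hl, ← sub_eq_add_neg]
    exact h.norm_qResolvent_le hl
  have hz₀ : ((ω + 1 : ℝ) : ℂ) ∈ {z : ℂ | z.im = 0 ∧ ω < z.re} := by simp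
  have hz₀' : -(-ω) < ((ω + 1 : ℝ) : ℂ).re := by rw [neg_neg]; simp
  obtain ⟨T, hT, hlap, hgen⟩ := exists_c0Semigroup_of_resolvent_bound h.isPseudoResolvent_qFamily hmem hbound hz₀ hz₀'
    (h.dense_range_qFamily hω1)
  refine ⟨T, fun t => by simpa using hT t, fun l hl x => ?_, ?_⟩
  · have := hlap l (by simpa using hl) (by rw [neg_neg]; simpa using hl) x
    rw [this, h.qFamily_ofReal hl]
  · rw [hgen, h.operatorOfResolvent_qFamily hω1]

end IsQuasiDissipativeData

/-! ### Hilbert space: `Re⟪Ax, x⟫ ≤ ω‖x‖²` -/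

section Hilbert

variable {H : Type*} [NormedAddCommGroup H] [InnerProductSpace ℂ H]

/-- **`Re⟪Ax, x⟫ ≤ ω‖x‖²` ⇒ quasi-dissipativity** `(λ − ω)‖x‖ ≤ ‖λx − Ax‖` (all real `λ`): indeed
`‖λx − Ax‖‖x‖ ≥ Re⟪x, λx − Ax⟫ = λ‖x‖² − Re⟪Ax, x⟫ ≥ (λ − ω)‖x‖²`. [cite: EngelNagel2000, Ch. II Prop. 3.23] -/
theorem quasiDissipative_of_re_inner_le {A : H →ₗ.[ℂ] H} {ω : ℝ}
    (hre : ∀ x : A.domain, (inner ℂ (A x) (x : H)).re ≤ ω * ‖(x : H)‖ ^ 2) (l : ℝ) (x : A.domain) :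
    (l - ω) * ‖(x : H)‖ ≤ ‖(l : ℂ) • (x : H) - A x‖ := by
  by_cases hx : (x : H) = 0
  · have hAx : A x = 0 := by
      have : x = 0 := Subtype.ext hx
      rw [this, LinearPMap.map_zero]
    rw [hx, hAx, smul_zero, sub_zero, norm_zero, mul_zero]
  have hxpos : 0 < ‖(x : H)‖ := norm_pos_iff.2 hx
  -- `Re⟪x, λx − Ax⟫ = λ‖x‖² − Re⟪Ax, x⟫`
  have hre' : (inner ℂ (x : H) ((l : ℂ) • (x : H) - A x)).re = l * ‖(x : H)‖ ^ 2 - (inner ℂ (A x) (x : H)).re := by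
    have hxx : (inner ℂ (x : H) (x : H)).re = ‖(x : H)‖ ^ 2 := by
      have := inner_self_eq_norm_sq (𝕜 := ℂ) (x : H)
      rwa [RCLike.re_to_complex] at this
    rw [inner_sub_right, inner_smul_right, Complex.sub_re, ← inner_conj_symm (x : H) (A x), Complex.conj_re,
      Complex.re_ofReal_mul, hxx]
  have hcs : (inner ℂ (x : H) ((l : ℂ) • (x : H) - A x)).re ≤ ‖(x : H)‖ * ‖(l : ℂ) • (x : H) - A x‖ :=
    (Complex.re_le_norm _).trans (norm_inner_le_norm _ _)
  have h1 : (l - ω) * ‖(x : H)‖ * ‖(x : H)‖ ≤ ‖(l : ℂ) • (x : H) - A x‖ * ‖(x : H)‖ := by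
    have := hre x
    nlinarith [hcs, hre', this]
  exact le_of_mul_le_mul_right h1 hxpos

/-- **Quasi-dissipative data from the numerical range**: dense domain, `Re⟪Ax, x⟫ ≤ ω‖x‖²` on `D(A)` and `λ − A` onto
for `λ > ω`. [cite: EngelNagel2000, Ch. II Prop. 3.23] -/
theorem IsQuasiDissipativeData.of_re_inner_le {A : H →ₗ.[ℂ] H} {ω : ℝ} (hd : Dense (A.domain : Set H))
    (hre : ∀ x : A.domain, (inner ℂ (A x) (x : H)).re ≤ ω * ‖(x : H)‖ ^ 2)
    (hsurj : ∀ l : ℝ, ω < l → ∀ y : H, ∃ x : A.domain, (l : ℂ) • (x : H) - A x = y) : IsQuasiDissipativeData A ω where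
  dense := hd
  dissipative l _ x := quasiDissipative_of_re_inner_le hre l x
  surj := hsurj

/-- **Generation from the numerical range (Hilbert space).** A densely defined operator with `Re⟪Ax, x⟫ ≤ ω‖x‖²` on
`D(A)` and `λ − A` onto for real `λ > ω` generates a C₀-semigroup with `‖T(t)‖ ≤ e^{ωt}` and `T.generator = A`.
[cite: EngelNagel2000, Ch. II Thm. 3.15] -/
theorem exists_c0Semigroup_of_re_inner_le [CompleteSpace H] {A : H →ₗ.[ℂ] H} {ω : ℝ} (hd : Dense (A.domain : Set H))
    (hre : ∀ x : A.domain, (inner ℂ (A x) (x : H)).re ≤ ω * ‖(x : H)‖ ^ 2)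
    (hsurj : ∀ l : ℝ, ω < l → ∀ y : H, ∃ x : A.domain, (l : ℂ) • (x : H) - A x = y) :
    ∃ T : C0Semigroup ℂ H, (∀ t : ℝ≥0, ‖T.app t‖ ≤ Real.exp (ω * t)) ∧ T.generator = A := by
  obtain ⟨T, hT, -, hgen⟩ := (IsQuasiDissipativeData.of_re_inner_le hd hre hsurj).exists_c0Semigroup
  exact ⟨T, hT, hgen⟩

/-- **The dissipative Hilbert case** (`Re⟪Ax, x⟫ ≤ 0`, `λ − A` onto for `λ > 0`; e.g. `A` self-adjoint and
nonpositive): `A` generates a contraction C₀-semigroup with `T.generator = A`. [cite: EngelNagel2000, Ch. II Thm. 3.15] -/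
theorem exists_c0Semigroup_of_re_inner_nonpos [CompleteSpace H] {A : H →ₗ.[ℂ] H} (hd : Dense (A.domain : Set H))
    (hre : ∀ x : A.domain, (inner ℂ (A x) (x : H)).re ≤ 0)
    (hsurj : ∀ l : ℝ, 0 < l → ∀ y : H, ∃ x : A.domain, (l : ℂ) • (x : H) - A x = y) :
    ∃ T : C0Semigroup ℂ H, T.IsContraction ∧ T.generator = A := by
  have hre' : ∀ x : A.domain, (inner ℂ (A x) (x : H)).re ≤ 0 * ‖(x : H)‖ ^ 2 := fun x => by rw [zero_mul]; exact hre x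
  obtain ⟨T, hT, hgen⟩ := exists_c0Semigroup_of_re_inner_le hd hre' hsurj
  exact ⟨T, fun t => by simpa using hT t, hgen⟩

end Hilbert

end HilleYosida

end Literature.Analysis.UnboundedOperators
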